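import Summits.ResolutionOfSingularities.ResolutionOfSingularities.Theorems.WildConesCampaignW46HypersurfacesCharTwoEmbDimDynamics

/-!
# [OURS · L1 W4.6, rung (ii) at p = 2, EVERY dimension n] The descent step with OFF-CHART linear
# hypotheses, tracking linear coefficients, and the EXACT formal drop with a free chart-linear
# coefficient — over every field of characteristic 2

HONEST FRAMING. Everything here is OURS: formal-power-series bookkeeping for route WildCones' TYPED
point-blow-up dynamics (`Theorems/WildConesClassicalRegimesDefs.lean`), extending the tree's
`WildCones.MuDropCharTwoOrdP.descent_step` / `exists_pair_ne` (`…StubMuDropCharTwoOrdP{Descent,BlowFam}.lean`)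
and the seat's gen-2 `descent_step_offChart` (`…ThreefoldsCharTwoNearPointExists.lean`, p481532) from
threefolds to every dimension: the hypothesis «the strict transform `G` has no linear terms» is weakened
to «no linear terms OFF the chart index», and the descended `G'` is shown to inherit exactly the linear
coefficients of `G` at the surviving indices — which is what an induction through ALL hyperbolic pairs
needs. NOTHING here is a statement of the manuscript [Hironaka2017]; no FACT-LIST premise; AI review is
weaker than expert review. Cell res-hironaka (LADDER-RESOLUTION rung L, D-0089), slot W4.6, seat
res-L1-s46-pv-4 (gen 3); host route `WildCones`, crux `ClassicalRegimes` (stmt-ResolutionOfSingularities-16884;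
proved). Used by `…HypersurfacesCharTwoNearPointExists.lean` (existence of the near double point).

WHAT IS PROVED (every `n`, characteristic `2` where marked):

* `coeff_single_subst_eq_sum` — the linear part of `g∘θ` for a family `θ` without constant terms:
  `[X_s](g∘θ) = Σ_t [X_t] g · [X_s] θ_t` (any field).
* `coeff_single_pairFamily_symm` — through the Greuel–Pfister pair family `θ' = (q⁻¹∂_l G, q⁻¹∂_j G, X_s)`
  (`G = G₁∘θ'`, `[X_j]G = [X_l]G = 0`): `[X_j]G₁ = [X_l]G₁ = 0` and `[X_s]G₁ = [X_s]G` otherwise.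
* `descent_step_offChart_lin` — gen 2's `descent_step_offChart` PLUS `[X_t] G' = [X_{e t}] G` for every
  surviving index (adapted proof, marked).
* `exists_pair_ne_offChart` — the tree's `exists_pair_ne` under the off-chart hypothesis only (adapted).
* `formal_drop_offChart` — THE EXACT DROP WITH A FREE `X_i`-LINEAR COEFFICIENT: `X_i² G = a∘Φ_{i,τ}`,
  `ord a ≥ 2`, `[X_m] G = 0` for `m ≠ i` only, `jetTwoColength a ≤ 2`, `a` isolated ⇒ `G` isolated with
  `dim` smaller by EXACTLY two (strong induction on `n`).

References: G.-M. Greuel, G. Pfister, J. Algebra 689 (2026) = arXiv:2507.17078, Thm 3.5 / Cor 3.7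
[GreuelPfister2026] (through the tree's `pair_reduction`, `descent`); H. Hironaka, ms. 2017 [Hironaka2017]
— nothing of it is used.
-/

noncomputable section

-- single-problem summit: the doubled namespace component `ResolutionOfSingularities` is forced
set_option linter.dupNamespace false

open scoped BigOperators Classical

open MvPowerSeries IsLocalRing

open Literature.AlgebraicGeometry.Resolution

namespace Summit.ResolutionOfSingularities.ResolutionOfSingularities.Theorems

namespace CampaignW46.HypersurfacesCharTwo

open WildCones WildCones.MuDropCharTwoOrdP ThreefoldsCharTwo

variable {κ : Type} [Field κ] {n : ℕ}

/-! ## Linear coefficients under a substitution without constant terms -/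

/-- [OURS · L1 W4.6] **The linear part of a substitution**: for a family `θ` without constant terms,
`[X_s] (g∘θ) = Σ_t [X_t] g · [X_s] θ_t` — only the linear part of `g` and the linear parts of the
`θ_t` contribute. [folklore] -/
theorem coeff_single_subst_eq_sum {θ : Fin n → MvPowerSeries (Fin n) κ}
    (h0 : ∀ s, constantCoeff (θ s) = 0) (g : MvPowerSeries (Fin n) κ) (s : Fin n) :
    coeff (Finsupp.single s 1) (subst θ g) =
      ∑ t, coeff (Finsupp.single t 1) g * coeff (Finsupp.single s 1) (θ t) := by
  have hθ : HasSubst θ := hasSubst_of_constantCoeff_zero h0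
  -- split `g` into constant part, linear part and a remainder of order `≥ 2`
  set g₂ := g - C (constantCoeff g) - ∑ t, C (coeff (Finsupp.single t 1) g) * X t with hg₂
  have hsplit : g = C (constantCoeff g) + ∑ t, C (coeff (Finsupp.single t 1) g) * X t + g₂ := by
    rw [hg₂]; ring
  have hlinX : ∀ u t : Fin n, coeff (Finsupp.single u 1) (C (coeff (Finsupp.single t 1) g) * X t :
      MvPowerSeries (Fin n) κ) = if u = t then coeff (Finsupp.single t 1) g else 0 := by
    intro u t
    rw [coeff_C_mul, coeff_index_single_X]
    split_ifs <;> simp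
  have h2 : 2 ≤ g₂.order := by
    rw [FormalCoordChange.two_le_order_iff]
    refine ⟨?_, fun u => ?_⟩
    · rw [hg₂, map_sub, map_sub, map_sum, constantCoeff_C]
      simp
    · rw [hg₂, map_sub, map_sub, map_sum, coeff_C, if_neg (Finsupp.single_ne_zero.mpr one_ne_zero)]
      simp_rw [hlinX]
      rw [Finset.sum_ite_eq Finset.univ u, if_pos (Finset.mem_univ u)]
      ring
  have h2' : 2 ≤ (subst θ g₂).order := FormalCoordChange.two_le_order_subst θ h0 g₂ h2
  have hrem : coeff (Finsupp.single s 1) (subst θ g₂) = 0 :=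
    ((FormalCoordChange.two_le_order_iff _).mp h2').2 s
  conv_lhs => rw [hsplit]
  rw [subst_add hθ, subst_add hθ, map_add, map_add, hrem, add_zero, subst_C, coeff_C,
    if_neg (Finsupp.single_ne_zero.mpr one_ne_zero), zero_add, ← coe_substAlgHom hθ, map_sum,
    map_sum]
  refine Finset.sum_congr rfl fun t _ => ?_
  rw [map_mul, coe_substAlgHom hθ, subst_C, subst_X hθ, coeff_C_mul]

/-- [OURS · L1 W4.6] **Linear coefficients through the pair-reduction automorphism.** For the pair
family `θ' = (q⁻¹ ∂_l G, q⁻¹ ∂_j G, X_s)` of `pair_reduction` (`[X_j X_l] G = q ≠ 0`) and `G = G₁∘θ'`: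
if `[X_j] G = [X_l] G = 0` then `[X_j] G₁ = [X_l] G₁ = 0` and `[X_s] G₁ = [X_s] G` for every other `s`
(the linear part of `θ'` is unipotent, triangular with respect to `{j, l}`). [folklore] -/
theorem coeff_single_pairFamily_symm [CharP κ 2] {G G₁ : MvPowerSeries (Fin n) κ} {j l : Fin n}
    (hjl : j ≠ l) {q : κ} (hq : q ≠ 0)
    (hqG : coeff (Finsupp.single j 1 + Finsupp.single l 1) G = q)
    (h0 : ∀ s, constantCoeff ((fun s => if s = j then q⁻¹ • MvPowerSeries.pderiv l G
      else if s = l then q⁻¹ • MvPowerSeries.pderiv j G else X s) s) = 0)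
    (hG : G = subst (fun s => if s = j then q⁻¹ • MvPowerSeries.pderiv l G
      else if s = l then q⁻¹ • MvPowerSeries.pderiv j G else X s) G₁)
    (hGj : coeff (Finsupp.single j 1) G = 0) (hGl : coeff (Finsupp.single l 1) G = 0) :
    coeff (Finsupp.single j 1) G₁ = 0 ∧ coeff (Finsupp.single l 1) G₁ = 0 ∧
      ∀ s, s ≠ j → s ≠ l → coeff (Finsupp.single s 1) G₁ = coeff (Finsupp.single s 1) G := by
  set θ' : Fin n → MvPowerSeries (Fin n) κ := fun s => if s = j then q⁻¹ • MvPowerSeries.pderiv l G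
      else if s = l then q⁻¹ • MvPowerSeries.pderiv j G else X s with hθ'
  -- linear coefficients of the family
  have hθ'j : θ' j = q⁻¹ • MvPowerSeries.pderiv l G := by simp [hθ']
  have hθ'l : θ' l = q⁻¹ • MvPowerSeries.pderiv j G := by simp [hθ', Ne.symm hjl]
  have hθ's : ∀ t, t ≠ j → t ≠ l → θ' t = X t := fun t htj htl => by simp [hθ', htj, htl]
  have cjj : coeff (Finsupp.single j 1) (θ' j) = 1 := by
    rw [hθ'j, coeff_smul, coeff_single_pderiv, Finsupp.single_apply, if_neg hjl, Nat.cast_zero,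
      zero_add, one_mul, hqG, inv_mul_cancel₀ hq]
  have clj : coeff (Finsupp.single l 1) (θ' j) = 0 := by
    rw [hθ'j, coeff_smul, coeff_single_pderiv, Finsupp.single_eq_same, Nat.cast_one,
      CharTwo.add_self_eq_zero, zero_mul, mul_zero]
  have cll : coeff (Finsupp.single l 1) (θ' l) = 1 := by
    rw [hθ'l, coeff_smul, coeff_single_pderiv, Finsupp.single_apply, if_neg (Ne.symm hjl),
      Nat.cast_zero, zero_add, one_mul, add_comm, hqG, inv_mul_cancel₀ hq]
  have cjl : coeff (Finsupp.single j 1) (θ' l) = 0 := by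
    rw [hθ'l, coeff_smul, coeff_single_pderiv, Finsupp.single_eq_same, Nat.cast_one,
      CharTwo.add_self_eq_zero, zero_mul, mul_zero]
  have cst : ∀ s t, t ≠ j → t ≠ l → coeff (Finsupp.single s 1) (θ' t) = if s = t then 1 else 0 :=
    fun s t htj htl => by rw [hθ's t htj htl, coeff_index_single_X]
  -- the expansion `[X_s] G = Σ_t [X_t] G₁ [X_s] θ'_t`, split at `j`, `l`
  have hexp : ∀ s, coeff (Finsupp.single s 1) G =
      coeff (Finsupp.single j 1) G₁ * coeff (Finsupp.single s 1) (θ' j) +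
        (coeff (Finsupp.single l 1) G₁ * coeff (Finsupp.single s 1) (θ' l) +
          ∑ t ∈ (Finset.univ.erase j).erase l,
            coeff (Finsupp.single t 1) G₁ * coeff (Finsupp.single s 1) (θ' t)) := by
    intro s
    have hl' : l ∈ Finset.univ.erase j := Finset.mem_erase.mpr ⟨Ne.symm hjl, Finset.mem_univ l⟩
    rw [hG, coeff_single_subst_eq_sum h0, ← Finset.add_sum_erase _ _ (Finset.mem_univ j),
      ← Finset.add_sum_erase _ _ hl']
  have hrest0 : ∀ s, (s = j ∨ s = l) → ∑ t ∈ (Finset.univ.erase j).erase l,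
      coeff (Finsupp.single t 1) G₁ * coeff (Finsupp.single s 1) (θ' t) = 0 := by
    intro s hs
    refine Finset.sum_eq_zero fun t ht => ?_
    have htl : t ≠ l := Finset.ne_of_mem_erase ht
    have htj : t ≠ j := Finset.ne_of_mem_erase (Finset.mem_of_mem_erase ht)
    rw [cst s t htj htl, if_neg (by rintro rfl; rcases hs with rfl | rfl <;> contradiction), mul_zero]
  have hj' : coeff (Finsupp.single j 1) G₁ = 0 := by
    have h := hexp j
    rw [hGj, cjj, cjl, hrest0 j (Or.inl rfl), mul_one, mul_zero, zero_add, add_zero] at h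
    exact h.symm
  have hl' : coeff (Finsupp.single l 1) G₁ = 0 := by
    have h := hexp l
    rw [hGl, clj, cll, hrest0 l (Or.inr rfl), mul_zero, mul_one, zero_add, add_zero] at h
    exact h.symm
  refine ⟨hj', hl', fun s hsj hsl => ?_⟩
  have h := hexp s
  have hs' : s ∈ (Finset.univ.erase j).erase l :=
    Finset.mem_erase.mpr ⟨hsl, Finset.mem_erase.mpr ⟨hsj, Finset.mem_univ s⟩⟩
  rw [hj', hl', zero_mul, zero_mul, zero_add, zero_add,
    Finset.sum_eq_single_of_mem s hs' (fun t ht hts => by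
      rw [cst s t (Finset.ne_of_mem_erase (Finset.mem_of_mem_erase ht)) (Finset.ne_of_mem_erase ht),
        if_neg (Ne.symm hts), mul_zero]),
    cst s s hsj hsl, if_pos rfl, mul_one] at h
  exact h.symm

/-! ## The descent step with off-chart linear hypotheses, keeping track of the linear coefficients -/

-- adapted from Theorems/WildConesCampaignW46ThreefoldsCharTwoNearPointExists.lean (`descent_step_offChart`,
-- itself adapted from the tree's `WildCones.MuDropCharTwoOrdP.descent_step`)

/-- [OURS · L1 W4.6] **THE DESCENT STEP WITH OFF-CHART LINEAR HYPOTHESES, tracking linear coefficients**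
(characteristic two; gen 2's `descent_step_offChart` with one more conclusion). Let `X_i² G = a∘Φ_{i,τ}`
with `ord a ≥ 2` and `[X_j X_l] a ≠ 0` for a pair `j ≠ l` avoiding `i`, and `[X_j] G = [X_l] G = 0`.
Killing `X_j, X_l` after the two pair reductions gives `a', G'` in `m = n - 2` variables in the same
blow-up relation, with isomorphic Milnor algebras, AND `[X_t] G' = [X_{e t}] G` for every surviving
index `t` (the pair-reduction automorphism has unipotent linear part, `coeff_single_pairFamily_symm`).
[cite: GreuelPfister2026, Thm 3.5 and Cor 3.7] -/
theorem descent_step_offChart_lin [CharP κ 2] {m : ℕ} (i : Fin n) (τ : Fin n → κ)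
    {a G : MvPowerSeries (Fin n) κ} (ha : 2 ≤ a.order)
    (hG : X i ^ 2 * G = subst (fun s => if s = i then (X i : MvPowerSeries (Fin n) κ)
      else X i * (X s + C (τ s))) a)
    {j l : Fin n} (hjl : j ≠ l) (hj : j ≠ i) (hl : l ≠ i)
    (hq : coeff (Finsupp.single j 1 + Finsupp.single l 1) a ≠ 0)
    (hGj : coeff (Finsupp.single j 1) G = 0) (hGl : coeff (Finsupp.single l 1) G = 0)
    (e : Fin m ↪ Fin n) (he : ∀ s, s ∈ Set.range e ↔ s ≠ j ∧ s ≠ l) (i' : Fin m) (hi' : e i' = i) :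
    ∃ a' G' : MvPowerSeries (Fin m) κ, 2 ≤ a'.order ∧
      X i' ^ 2 * G' = subst (fun t => if t = i' then (X i' : MvPowerSeries (Fin m) κ)
        else X i' * (X t + C (τ (e t)))) a' ∧
      Nonempty ((MvPowerSeries (Fin n) κ ⧸ Ideal.span (Set.range fun s => MvPowerSeries.pderiv s a))
        ≃ₐ[κ] (MvPowerSeries (Fin m) κ ⧸ Ideal.span (Set.range fun t => MvPowerSeries.pderiv t a'))) ∧
      Nonempty ((MvPowerSeries (Fin n) κ ⧸ Ideal.span (Set.range fun s => MvPowerSeries.pderiv s G))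
        ≃ₐ[κ] (MvPowerSeries (Fin m) κ ⧸ Ideal.span (Set.range fun t => MvPowerSeries.pderiv t G'))) ∧
      ∀ t, coeff (Finsupp.single t 1) G' = coeff (Finsupp.single (e t) 1) G := by
  have ha' := (FormalCoordChange.two_le_order_iff a).mp ha
  have hqG : coeff (Finsupp.single j 1 + Finsupp.single l 1) G =
      coeff (Finsupp.single j 1 + Finsupp.single l 1) a := coeff_pair_strict i τ ha hG hjl hj hl
  obtain ⟨F, hθ0, hF, hJ, hdj, hdl, hXj, hXl⟩ := pair_reduction hjl hq (ha'.2 j) (ha'.2 l)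
  obtain ⟨F', hθ'0, hF', hJ', hdj', hdl', hXj', hXl'⟩ :=
    pair_reduction (f := G) hjl (by rw [hqG]; exact hq) hGj hGl
  rw [hqG] at hθ'0 hF'
  set q := coeff (Finsupp.single j 1 + Finsupp.single l 1) a with hq'
  set θ : Fin n → MvPowerSeries (Fin n) κ := fun s => if s = j then q⁻¹ • MvPowerSeries.pderiv l a
      else if s = l then q⁻¹ • MvPowerSeries.pderiv j a else X s with hθ
  set θ' : Fin n → MvPowerSeries (Fin n) κ := fun s => if s = j then q⁻¹ • MvPowerSeries.pderiv l G
      else if s = l then q⁻¹ • MvPowerSeries.pderiv j G else X s with hθ'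
  have hθsub : HasSubst θ := hasSubst_of_constantCoeff_zero hθ0
  have hθ'sub : HasSubst θ' := hasSubst_of_constantCoeff_zero hθ'0
  have hΦ := hasSubst_blowFam i τ
  -- the translation vector with the `j`, `l` components zeroed
  set τ' : Fin n → κ := Function.update (Function.update τ j 0) l 0 with hτ'
  have hτ'j : τ' j = 0 := by
    rw [hτ', Function.update_of_ne hjl, Function.update_self]
  have hτ'l : τ' l = 0 := by rw [hτ', Function.update_self]
  have hτ's : ∀ s, s ≠ j → s ≠ l → τ' s = τ s := fun s hsj hsl => by
    rw [hτ', Function.update_of_ne hsl, Function.update_of_ne hsj]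
  have hΦ' := hasSubst_blowFam i τ'
  have hθi : θ i = X i := by simp [hθ, Ne.symm hj, Ne.symm hl]
  have hθ'i : θ' i = X i := by simp [hθ', Ne.symm hj, Ne.symm hl]
  -- STEP A: the two composite substitution families agree
  have hfam : ∀ s, subst (fun s => if s = i then (X i : MvPowerSeries (Fin n) κ)
      else X i * (X s + C (τ s))) (θ s) =
      subst θ' ((fun s => if s = i then (X i : MvPowerSeries (Fin n) κ) else X i * (X s + C (τ' s))) s) := by
    intro s
    by_cases hsj : s = j
    · rw [hsj]
      simp only [hθ, hθ', if_true, if_neg hj, hτ'j, map_zero, add_zero]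
      rw [subst_smul hΦ, ← X_mul_pderiv_strict_of_ne i τ hl hG, subst_mul hθ'sub, subst_X hθ'sub,
        subst_X hθ'sub, hθ'i]
      simp only [hθ', if_true, mul_smul_comm]
    · by_cases hsl : s = l
      · rw [hsl]
        simp only [hθ, hθ', if_neg (Ne.symm hjl), if_true, if_neg hl, hτ'l, map_zero, add_zero]
        rw [subst_smul hΦ, ← X_mul_pderiv_strict_of_ne i τ hj hG, subst_mul hθ'sub, subst_X hθ'sub,
          subst_X hθ'sub, hθ'i]
        simp only [hθ', if_neg (Ne.symm hjl), if_true, mul_smul_comm]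
      · have hθs : θ s = X s := by simp [hθ, hsj, hsl]
        have hθ's : θ' s = X s := by simp [hθ', hsj, hsl]
        rw [hθs, subst_X hΦ]
        by_cases hsi : s = i
        · rw [hsi]; simp only [if_true]; rw [subst_X hθ'sub, hθ'i]
        · simp only [if_neg hsi, hτ's s hsj hsl]
          rw [subst_mul hθ'sub, subst_add hθ'sub, subst_X hθ'sub, subst_X hθ'sub, subst_C,
            hθ'i, hθ's]
  have hcomm : ∀ g, subst (fun s => if s = i then (X i : MvPowerSeries (Fin n) κ)
      else X i * (X s + C (τ s))) (F g) =
      F' (subst (fun s => if s = i then (X i : MvPowerSeries (Fin n) κ) else X i * (X s + C (τ' s))) g) := by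
    intro g
    rw [hF, hF', subst_comp_subst_apply hθsub hΦ, subst_comp_subst_apply hΦ' hθ'sub]
    congr 1
    funext s
    exact hfam s
  -- STEP B: the reduced pair is again a strict-transform pair
  set a1 := F.symm a with ha1
  set G1 := F'.symm G with hG1
  have hFX' : F' (X i) = X i := by rw [hF', subst_X hθ'sub, hθ'i]
  have hB : X i ^ 2 * G1 = subst (fun s => if s = i then (X i : MvPowerSeries (Fin n) κ)
      else X i * (X s + C (τ' s))) a1 := by
    apply F'.injective
    have : a = F a1 := (F.apply_symm_apply a).symm
    rw [map_mul, map_pow, hFX', hG1, F'.apply_symm_apply, hG, this, hcomm]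
  -- the linear coefficients of `G1`
  have hGG1 : G = subst θ' G1 := by rw [← hF', hG1, F'.apply_symm_apply]
  obtain ⟨-, -, hlinG1⟩ := coeff_single_pairFamily_symm hjl hq hqG hθ'0 hGG1 hGj hGl
  -- STEP C: kill `X_j`, `X_l`
  refine ⟨killCompl e a1, killCompl e G1, two_le_order_killCompl e (le_order_algEquiv F.symm ha),
    ?_, descent e he F hJ hdj hdl hXj hXl, descent e he F' hJ' hdj' hdl' hXj' hXl', fun t => ?_⟩
  · have hC := congrArg (killCompl e) hB
    rw [map_mul, map_pow, ← hi', killCompl_X, killCompl_subst e (constantCoeff_blowFam (e i') τ')] at hC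
    rw [hC, ← subst_extend_eq_subst_killCompl e he _ (constantCoeff_blowFam i' (fun t => τ (e t)))]
    congr 1
    funext s
    by_cases hs : ∃ t, e t = s
    · obtain ⟨t, rfl⟩ := hs
      rw [e.injective.extend_apply]
      have hne : e t ≠ j ∧ e t ≠ l := (he (e t)).mp ⟨t, rfl⟩
      by_cases hti : t = i'
      · rw [if_pos (congrArg e hti), if_pos hti, killCompl_X]
      · rw [if_neg (fun h => hti (e.injective h)), if_neg hti, map_mul, map_add, killCompl_X,
          killCompl_X, killCompl_C, hτ's _ hne.1 hne.2]
    · rw [Function.extend_apply' _ _ _ hs, Pi.zero_apply]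
      have hs' : s = j ∨ s = l := by
        have := (he s).not.mp hs
        tauto
      have hsi : s ≠ e i' := fun h => hs ⟨i', h.symm⟩
      simp only [if_neg hsi, map_mul, map_add, killCompl_C]
      rw [killCompl_X_eq_zero (fun h => hs h), zero_add]
      rcases hs' with rfl | rfl
      · rw [hτ'j, map_zero, mul_zero]
      · rw [hτ'l, map_zero, mul_zero]
  · have hne : e t ≠ j ∧ e t ≠ l := (he (e t)).mp ⟨t, rfl⟩
    rw [coeff_single_killCompl, hlinG1 (e t) hne.1 hne.2]

/-! ## A pair away from the chart index, with off-chart linear hypotheses only -/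

-- adapted from Theorems/WildConesClassicalRegimesStubMuDropCharTwoOrdPBlowFam.lean (`exists_pair_ne`)

/-- [OURS · L1 W4.6] **A pair away from the chart index** (the tree's `exists_pair_ne` with its hypothesis
«`G` has no linear terms» weakened to «no linear terms OFF the chart index», which is all its proof uses):
if `a` has a square-free quadratic monomial and `[X_m] G = 0` for `m ≠ i`, then `a` has a square-free
quadratic monomial avoiding `i`. [folklore] -/
theorem exists_pair_ne_offChart [CharP κ 2] {i : Fin n} {τ : Fin n → κ} {a G : MvPowerSeries (Fin n) κ}
    (ha : 2 ≤ a.order)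
    (hG : X i ^ 2 * G = subst (fun s => if s = i then (X i : MvPowerSeries (Fin n) κ)
      else X i * (X s + C (τ s))) a)
    (hlin : ∀ m, m ≠ i → coeff (Finsupp.single m 1) G = 0)
    (hpair : ∃ j l : Fin n, j ≠ l ∧ coeff (Finsupp.single j 1 + Finsupp.single l 1) a ≠ 0) :
    ∃ j l : Fin n, j ≠ l ∧ j ≠ i ∧ l ≠ i ∧
      coeff (Finsupp.single j 1 + Finsupp.single l 1) a ≠ 0 := by
  by_contra H
  push Not at H
  have hthrough : ∀ m, m ≠ i → coeff (Finsupp.single i 1 + Finsupp.single m 1) a = 0 := by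
    intro m hm
    have h := coeff_single_strict i τ ha hG hm
    rw [hlin m hm] at h
    have hsum : ∑ s ∈ Finset.univ.erase i, τ s * ((((Finsupp.single s 1 : Fin n →₀ ℕ) m : ℕ) : κ) + 1) *
        coeff (Finsupp.single s 1 + Finsupp.single m 1) a = 0 := by
      refine Finset.sum_eq_zero fun s hs => ?_
      have hsi : s ≠ i := Finset.ne_of_mem_erase hs
      by_cases hsm : s = m
      · subst hsm
        have : (((Finsupp.single s 1 : Fin n →₀ ℕ) s : ℕ) : κ) + 1 = 0 := by
          simp only [Finsupp.single_eq_same, Nat.cast_one]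
          exact CharTwo.add_self_eq_zero 1
        rw [this, mul_zero, zero_mul]
      · rw [H s m hsm hsi hm, mul_zero]
    rw [hsum, add_zero] at h
    exact h.symm
  obtain ⟨j, l, hjl, hne⟩ := hpair
  apply hne
  by_cases hj : j = i
  · subst hj
    exact hthrough l (Ne.symm hjl)
  · by_cases hl : l = i
    · subst hl
      rw [add_comm]
      exact hthrough j hj
    · exact H j l hjl hj hl

/-! ## The formal drop with a free chart-linear coefficient -/

/-- [OURS · L1 W4.6] **THE EXACT FORMAL DROP WITH A FREE `X_i`-LINEAR COEFFICIENT** (characteristic two,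
every `n`): for the blow-up relation `X_i² G = a∘Φ_{i,τ}` with `ord a ≥ 2`, `[X_m] G = 0` for `m ≠ i`
ONLY, embedding dimension of `a` at most one (`jetTwoColength a ≤ 2`) and finite Milnor algebra of `a`:
the Milnor algebra of `G` is finite of dimension SMALLER BY EXACTLY TWO. The induction of
`formal_trichotomy` along `descent_step_offChart_lin` (which carries the off-chart hypothesis down) and
`exists_pair_ne_offChart`; leaf `n = 1` the curve leaf. [cite: GreuelPfister2026, Thm 3.5 and Cor 3.7] -/
theorem formal_drop_offChart [CharP κ 2] : ∀ (n : ℕ) (i : Fin n) (τ : Fin n → κ)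
    (a G : MvPowerSeries (Fin n) κ), 2 ≤ a.order → (∀ m, m ≠ i → coeff (Finsupp.single m 1) G = 0) →
    X i ^ 2 * G = subst (fun s => if s = i then (X i : MvPowerSeries (Fin n) κ)
      else X i * (X s + C (τ s))) a →
    jetTwoColength a ≤ 2 →
    Module.Finite κ (MvPowerSeries (Fin n) κ ⧸
      Ideal.span (Set.range fun s => MvPowerSeries.pderiv s a)) →
    Module.Finite κ (MvPowerSeries (Fin n) κ ⧸
        Ideal.span (Set.range fun s => MvPowerSeries.pderiv s G)) ∧
      Module.finrank κ (MvPowerSeries (Fin n) κ ⧸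
          Ideal.span (Set.range fun s => MvPowerSeries.pderiv s G)) + 2 =
        Module.finrank κ (MvPowerSeries (Fin n) κ ⧸
          Ideal.span (Set.range fun s => MvPowerSeries.pderiv s a)) := by
  intro n
  induction n using Nat.strong_induction_on with
  | _ n ih =>
  intro i τ a G ha hG0 hG hcol hfa
  by_cases hpair : ∃ j l : Fin n, j ≠ l ∧ coeff (Finsupp.single j 1 + Finsupp.single l 1) a ≠ 0
  · obtain ⟨j, l, hjl, hj, hl, hq⟩ := exists_pair_ne_offChart ha hG hG0 hpair
    obtain ⟨e, i', he, hi', -⟩ := exists_compl_embedding hjl (Ne.symm hj) (Ne.symm hl)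
    obtain ⟨a', G', ha', hG', ⟨εa⟩, ⟨εG⟩, hlin⟩ :=
      descent_step_offChart_lin i τ ha hG hjl hj hl hq (hG0 j hj) (hG0 l hl) e he i' hi'
    have hlt : n - 2 < n := by
      have := Fin.pos i
      omega
    have hca : jetTwoColength a = jetTwoColength a' := jetTwoColength_eq_of_equiv εa
    have hG0' : ∀ t, t ≠ i' → coeff (Finsupp.single t 1) G' = 0 := by
      intro t ht
      rw [hlin t]
      exact hG0 (e t) (fun h => ht (e.injective (h.trans hi'.symm)))
    haveI := hfa
    obtain ⟨hfG', hdrop⟩ := ih (n - 2) hlt i' (fun t => τ (e t)) a' G' ha' hG0' hG'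
      (by rw [← hca]; exact hcol) (Module.Finite.equiv εa.toLinearEquiv)
    haveI := hfG'
    refine ⟨Module.Finite.equiv εG.symm.toLinearEquiv, ?_⟩
    rw [εa.toLinearEquiv.finrank_eq, εG.toLinearEquiv.finrank_eq]
    exact hdrop
  · push Not at hpair
    have ha' := (FormalCoordChange.two_le_order_iff a).mp ha
    have hcol' : jetTwoColength a = n + 1 := jetTwoColength_of_no_pair ha'.2 hpair
    rcases n with _ | _ | n
    · exact i.elim0
    · have hfG := curve_finite_strict i τ hG hfa
      exact ⟨hfG, JacobianBudget.CharTwo.curve_drop_eq i τ hG hfG⟩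
    · omega


end CampaignW46.HypersurfacesCharTwo

end Summit.ResolutionOfSingularities.ResolutionOfSingularities.Theorems

end
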